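import Mathlib
import HarnessLib

/-!
# Engine: a `Γ`-stable subgroup containing the invariants and divisible by `γ − 1` exhausts every
# locally unipotent `p`-primary element («surjectivity from invariants + coinvariants»)

Route `ThetaPartnerAtTwo` (TP2), crux K1 `SignedTransportAtTwo` (stmt-BirchSwinnertonDyer-20333), line `bridge` v23, registered
research stub `stub_surj2` (Greenberg–Vatsal Prop. (2.1) READ AT `p = 2`, signed: the detecting map of the non-primitive signed
Selmer group onto the product of the local factors is ONTO). Seat `prover-bsd-wall-tp2-p3-w2` (K4 width seat 2/3, g3), serving K1.

THE ENGINE (pure algebra, Mathlib only). `F` an abelian group, `T` an additive endomorphism (the action of a topological generator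
`γ`), `I ≤ G₀ ≤ F` subgroups with `T G₀ ⊆ G₀`. If
* every `f ∈ G₀` is `p`-power torsion and fixed by some `T^{p^k}` (a discrete `p`-primary `ℤ_p`-module: then `T − 1` is LOCALLY
  NILPOTENT on `G₀`, `sub_one_pow_apply_eq_zero`, from `(X − 1)^{p^k} ≡ X^{p^k} − 1 (mod p)`),
* `G₀^{T} ⊆ I` («the invariants are hit») and `I ⊆ (T − 1) I` («`I_Γ = 0`»),
then `G₀ ≤ I` (`le_of_fixed_le_of_le_sub_image`; induction on the nilpotence index). In the application (sequel file
`…SignedTransportAtTwoSharpSurjOfPrint`): `F` = families of local classes at the places of `ℚ_∞` above `S₀`, `I` = image of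
`Sel♯_{S₀}(E/ℚ_∞)`, the invariants are hit by Cassels' theorem over `ℚ`, and `I_Γ = 0` is the non-primitive COINV — replacing the
layer-wise Poitou–Tate argument of the printed proof of GV Prop. (2.1).

HONEST FRAMING: THEOREMS ONLY (no definition, no named fact, no `sorry`), generic algebra; closes no item; BSD is not proved by any
of this.

References: [GreenbergVatsal2000] §2 Prop. (2.1) (p. 23); [GreenbergLNM1716] §4 pp. 104, 119; [Washington1997] §13.2 (Λ-modules).
-/

set_option autoImplicit false
-- the Theorems namespace of this sub repeats the summit name by design (D-0017 nested layout)
set_option linter.dupNamespace false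

open Polynomial

namespace Summit.BirchSwinnertonDyer.BirchSwinnertonDyer.Theorems.SignedEC.SurjEngine

/-! ## §1. `(X − 1)^{p^k} ≡ X^{p^k} − 1 (mod p)` in `ℤ[X]` -/

/-- **`p ∣ (X − 1)^{p^k} − (X^{p^k} − 1)` in `ℤ[X]`** (freshman's dream in `(ℤ/p)[X]`, lifted coefficientwise). [folklore] -/
theorem C_dvd_X_sub_one_pow_sub (p : ℕ) [hp : Fact p.Prime] (k : ℕ) :
    (C (p : ℤ)) ∣ ((X - 1 : ℤ[X]) ^ (p ^ k) - (X ^ (p ^ k) - 1)) := by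
  rw [C_dvd_iff_dvd_coeff]
  intro n
  have hmap : ((X - 1 : ℤ[X]) ^ (p ^ k) - (X ^ (p ^ k) - 1)).map (Int.castRingHom (ZMod p)) = 0 := by
    rw [Polynomial.map_sub, Polynomial.map_pow, Polynomial.map_sub, Polynomial.map_sub, Polynomial.map_pow,
      Polynomial.map_X, Polynomial.map_one, sub_pow_char_pow, one_pow, sub_self]
  have hn := congrArg (fun q : (ZMod p)[X] ↦ q.coeff n) hmap
  simp only [coeff_map, eq_intCast, coeff_zero] at hn
  exact (ZMod.intCast_zmod_eq_zero_iff_dvd _ p).mp hn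

/-! ## §2. Local nilpotence of `T − 1` on `p`-power-torsion elements fixed by `T^{p^k}` -/

variable {F : Type*} [AddCommGroup F]

/-- **`T − 1` is locally nilpotent**: if `T^{p^k} f = f` and `p^j • f = 0` then `(T − 1)^{p^k·j} f = 0`. Write
`(T − 1)^{p^k} = T^{p^k} − 1 + p·Q` with `Q` a polynomial in `T` (§1); then `(T − 1)^{p^k} f = p • Q f`, and `Q f` is again
`T^{p^k}`-fixed and `p^j`-torsion; induct on `j`. (The `Λ = ℤ_p⟦T⟧`-module reading: a discrete `p`-primary `Γ`-module is
`(p, T)`-adically locally nilpotent.) [cite: Washington1997, §13.2] -/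
theorem sub_one_pow_apply_eq_zero (p : ℕ) [hp : Fact p.Prime] (T : Module.End ℤ F) (k : ℕ) :
    ∀ (j : ℕ) (f : F), (T ^ p ^ k) f = f → p ^ j • f = 0 → ((T - 1) ^ (p ^ k * j)) f = 0 := by
  -- the polynomial identity, evaluated at `T`
  obtain ⟨q, hq⟩ := C_dvd_X_sub_one_pow_sub p k
  set Q : Module.End ℤ F := aeval T q with hQ
  have hkey : (T - 1) ^ p ^ k = T ^ p ^ k - 1 + (p : Module.End ℤ F) * Q := by
    have e : (X - 1 : ℤ[X]) ^ (p ^ k) = (X ^ (p ^ k) - 1) + C (p : ℤ) * q := by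
      rw [← hq]; ring
    have h2 := congrArg (fun r : ℤ[X] ↦ aeval T r) e
    simp only [map_pow, map_sub, map_add, map_mul, aeval_X, map_one, aeval_C, algebraMap_int_eq,
      Int.coe_castRingHom, Int.cast_natCast] at h2
    rw [h2]
  -- `Q` commutes with `T`
  have hcomm : T * Q = Q * T := by
    have h1 : aeval T (X * q) = aeval T (q * X) := by rw [mul_comm]
    simpa only [map_mul, aeval_X, hQ] using h1
  have hcommk : T ^ p ^ k * Q = Q * T ^ p ^ k := (Commute.pow_left hcomm (p ^ k)).eq
  intro j
  induction j with
  | zero =>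
    intro f _ htor
    rw [pow_zero, one_smul] at htor
    rw [htor, map_zero]
  | succ j ih =>
    intro f hfix htor
    have hstep : ((T - 1) ^ p ^ k) f = p • Q f := by
      rw [hkey, LinearMap.add_apply, LinearMap.sub_apply, hfix, Module.End.one_apply, sub_self, zero_add,
        Module.End.mul_apply, Module.End.natCast_apply]
    have hfix' : (T ^ p ^ k) (p • Q f) = p • Q f := by
      rw [map_nsmul, ← Module.End.mul_apply, hcommk, Module.End.mul_apply, hfix]
    have htor' : p ^ j • (p • Q f) = 0 := by
      rw [smul_smul, ← map_nsmul, ← pow_succ, htor, map_zero]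
    rw [Nat.mul_succ, pow_add, Module.End.mul_apply, hstep]
    exact ih _ hfix' htor'

/-! ## §3. The criterion -/

/-- **Surjectivity from invariants and coinvariants.** `I ≤ G₀ ≤ F`, `T G₀ ⊆ G₀`, `T − 1` locally nilpotent on `G₀`; if every
`T`-fixed element of `G₀` lies in `I` and every element of `I` is `T j − j` for some `j ∈ I`, then `G₀ ≤ I`: for `f ∈ G₀` with
`(T − 1)^{N+1} f = 0`, `(T − 1) f ∈ I` by induction, `= T j − j`, so `f − j` is `T`-fixed, hence in `I`. (Snake-lemma reading:
`0 → I → G₀ → C → 0`, `G₀^Γ ⊆ I` and `I_Γ = 0` give `C^Γ = 0`, and a locally nilpotent `Γ`-module with no invariants is `0`.)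
[cite: GreenbergVatsal2000, §2 Prop. (2.1)] [cite: GreenbergLNM1716, §4 p. 104] -/
theorem le_of_fixed_le_of_le_sub_image (T : Module.End ℤ F) (I G₀ : AddSubgroup F) (hIG : I ≤ G₀)
    (hTG : ∀ f ∈ G₀, T f ∈ G₀) (hnil : ∀ f ∈ G₀, ∃ N : ℕ, ((T - 1) ^ N) f = 0)
    (hfix : ∀ f ∈ G₀, T f = f → f ∈ I) (hcoinv : ∀ i ∈ I, ∃ j ∈ I, T j - j = i) :
    G₀ ≤ I := by
  suffices h : ∀ (N : ℕ) (f : F), f ∈ G₀ → ((T - 1) ^ N) f = 0 → f ∈ I by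
    intro f hf
    obtain ⟨N, hN⟩ := hnil f hf
    exact h N f hf hN
  intro N
  induction N with
  | zero =>
    intro f _ h0
    rw [pow_zero, Module.End.one_apply] at h0
    rw [h0]
    exact I.zero_mem
  | succ N ih =>
    intro f hf hN
    have hTf : T f - f ∈ G₀ := G₀.sub_mem (hTG f hf) hf
    have h1 : ((T - 1) ^ N) (T f - f) = 0 := by
      have e : ((T - 1) ^ (N + 1)) f = ((T - 1) ^ N) ((T - 1) f) := by
        rw [pow_succ, Module.End.mul_apply]
      rw [e, LinearMap.sub_apply, Module.End.one_apply] at hN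
      exact hN
    obtain ⟨j, hjI, hj⟩ := hcoinv _ (ih _ hTf h1)
    have hfj : T (f - j) = f - j := by
      rw [map_sub]
      have : T f - f = T j - j := hj.symm
      -- `T f - T j = f - j`
      rw [sub_eq_sub_iff_sub_eq_sub] at this
      exact this
    have hmem : f - j ∈ I := hfix _ (G₀.sub_mem hf (hIG hjI)) hfj
    have : f = (f - j) + j := by abel
    rw [this]
    exact I.add_mem hmem hjI

/-- **The criterion for discrete `p`-primary locally unipotent elements**: as `le_of_fixed_le_of_le_sub_image`, with local
nilpotence supplied by §2 from «every `f ∈ G₀` is `p`-power torsion and fixed by some `T^{p^k}`».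
[cite: GreenbergVatsal2000, §2 Prop. (2.1)] [cite: Washington1997, §13.2] -/
theorem le_of_fixed_le_of_le_sub_image_of_torsion (p : ℕ) [hp : Fact p.Prime] (T : Module.End ℤ F)
    (I G₀ : AddSubgroup F) (hIG : I ≤ G₀) (hTG : ∀ f ∈ G₀, T f ∈ G₀)
    (hper : ∀ f ∈ G₀, ∃ k : ℕ, (T ^ p ^ k) f = f) (htor : ∀ f ∈ G₀, ∃ j : ℕ, p ^ j • f = 0)
    (hfix : ∀ f ∈ G₀, T f = f → f ∈ I) (hcoinv : ∀ i ∈ I, ∃ j ∈ I, T j - j = i) :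
    G₀ ≤ I := by
  refine le_of_fixed_le_of_le_sub_image T I G₀ hIG hTG (fun f hf ↦ ?_) hfix hcoinv
  obtain ⟨k, hk⟩ := hper f hf
  obtain ⟨j, hj⟩ := htor f hf
  exact ⟨p ^ k * j, sub_one_pow_apply_eq_zero p T k j f hk hj⟩

end Summit.BirchSwinnertonDyer.BirchSwinnertonDyer.Theorems.SignedEC.SurjEngine
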